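import Summits.AtomisticToContinuum.HydrodynamicLimit.Theses.CollisionIsometryCLT

/-!
# Sketch — crux MacroClosure (stmt-AtomisticToContinuum-14670), idea `steered-maxwellians-freevolume-ceiling`

First-lemma signatures for the crux idea card (crux-ideate round 1, ideator 1).
Everything is stated over existing declarations; nothing here is proved (defs of `Prop`s only).
-/

noncomputable section

open MeasureTheory Filter Set Topology InformationTheory
open scoped ENNReal

namespace Summit.AtomisticToContinuum.HydrodynamicLimit.Cruxes.MacroClosure.SteeredMaxwellians

open Literature.MathematicalPhysics.KineticTheory Literature.Analysis.FluidPDE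

/-- The crux, by name (anchor). -/
example : Summit.AtomisticToContinuum.HydrodynamicLimit.Theses.CollisionIsometryCLT.MacroClosure =
    (Summit.AtomisticToContinuum.HydrodynamicLimit.Theses.CollisionIsometryCLT.CollisionalTransferLocality →
      Summit.AtomisticToContinuum.HydrodynamicLimit.Theses.CollisionIsometryCLT.AprioriBounds →
      Summit.AtomisticToContinuum.HydrodynamicLimit.Theses.CollisionIsometryCLT.FastMomentRelaxation →
      _root_.HydrodynamicLimit) := rfl

/-- `(N+1)`-sphere phase space on `𝕋³`. -/
abbrev Cfg (N : ℕ) : Type := Config (N + 1) (Fin 3) T3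

/-- Hard-sphere flows at reduced density `σ`. -/
abbrev Flow (σ : ℝ) (N : ℕ) : Type :=
  HardSphereFlow (Torus.geometry (Fin 3)) (hsDiameter σ N) (N + 1)

/-- The time-`t` law `P_t = (Φ_t)_# localGibbsLaw`. -/
def lawAt (σ : ℝ) (a₀ θ₀ : T3 → ℝ) (u₀ : T3 → V3) (N : ℕ) (Φ : Flow σ N) (t : ℝ) :
    Measure (Cfg N) :=
  (localGibbsLaw σ a₀ u₀ θ₀ N Φ).map (Φ.flow t)

/-- The HALF-STEERED reference `R_t`: uniform positions on the hard-core set (activity `≡ 1`)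
times Maxwellians steered by the classical fields `(u, θ)(t, ·)`. Its normaliser does not depend
on `t` (each Maxwellian integrates to `1`), which is what makes the steering identity exact. -/
def steeredRef (σ : ℝ) (u : ℝ → T3 → V3) (θ : ℝ → T3 → ℝ) (N : ℕ) (Φ : Flow σ N) (t : ℝ) :
    Measure (Cfg N) :=
  localGibbsLaw σ (fun _ => 1) (u t) (θ t) N Φ

/-- `log` of the steering Maxwellian, read as a one-particle observable. -/
def logMaxwellian (u : ℝ → T3 → V3) (θ : ℝ → T3 → ℝ) (t : ℝ) (y : T3 × V3) : ℝ :=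
  -‖y.2 - u t y.1‖ ^ 2 / (2 * θ t y.1) - 3 / 2 * Real.log (2 * Real.pi * θ t y.1)

/-- Positions of a configuration. -/
def pos {N : ℕ} (z : Cfg N) : Fin (N + 1) → T3 := fun i => (z i).1

/-- FIRST LEMMA (steering identity; exact, finite `N`, any `t`, any smooth steering fields).
Liouville invariance (`HardSphereFlow.measurePreserving`, a.e. invertibility) makes
`∫ f_t log f_t` constant and the reference normaliser is `t`-independent, so the relative entropy
of the TRUE time-`t` law w.r.t. the half-steered reference changes only through the empirical
observable `⟨μ_z, log M_{u(t),θ(t)}⟩` — whose increments are exactly the `(ψ, χ) = (u/θ, -1/θ)`-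
tested Irving–Kirkwood balance that `CollisionalTransferLocality` and `FastMomentRelaxation`
describe. -/
def SteeringIdentity : Prop :=
  ∀ (σ : ℝ) (a₀ θ₀ : T3 → ℝ) (u₀ : T3 → V3) (u : ℝ → T3 → V3) (θ : ℝ → T3 → ℝ),
    0 < σ → σ < 2⁻¹ → Continuous a₀ → Continuous θ₀ → Continuous u₀ →
    (∀ x, 0 < a₀ x) → (∀ x, 0 < θ₀ x) →
    (∀ t, Continuous (u t)) → (∀ t, Continuous (θ t)) → (∀ t x, 0 < θ t x) →
    ∀ (N : ℕ) (Φ : Flow σ N) (t : ℝ),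
      klDiv (lawAt σ a₀ θ₀ u₀ N Φ t) (steeredRef σ u θ N Φ t) ≠ ∞ ∧
      (klDiv (lawAt σ a₀ θ₀ u₀ N Φ t) (steeredRef σ u θ N Φ t)).toReal
          - (klDiv (lawAt σ a₀ θ₀ u₀ N Φ 0) (steeredRef σ u θ N Φ 0)).toReal
        = ((N : ℝ) + 1) *
          ((∫ z, (∫ y, logMaxwellian u θ 0 y ∂(empiricalMeasure z)) ∂(localGibbsLaw σ a₀ u₀ θ₀ N Φ))
            - ∫ z, (∫ y, logMaxwellian u θ t y ∂(empiricalMeasure (Φ.flow t z)))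
                ∂(localGibbsLaw σ a₀ u₀ θ₀ N Φ))

/-- The VELOCITY HALF of the line's conclusion (the conditional Maxwellian entropy is `o(N)`):
by the chain rule the conditional relative entropy of the velocities given the positions,
`K_N(t) = H(P_t | R_t) - H(pos_# P_t | pos_# R_t)`, controls — through Cramér bounds for
INDEPENDENT Gaussians, no thermodynamics — the block momentum and energy fields around
`(ρ̄ u(t), ρ̄(|u|²/2 + 3θ/2)(t))`. -/
def ConditionalMaxwellianEntropyVanishes : Prop :=
  ∀ (a₀ θ₀ : T3 → ℝ) (u₀ : T3 → V3), Continuous a₀ → Continuous θ₀ → Continuous u₀ →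
    (∀ x, 0 < a₀ x) → (∀ x, 0 < θ₀ x) →
    ∃ σ₀ : ℝ, 0 < σ₀ ∧ ∀ σ : ℝ, 0 < σ → σ < σ₀ →
      ∀ (T : ℝ) (ρ θ : ℝ → T3 → ℝ) (u : ℝ → T3 → V3), IsHardSphereEulerSolution σ T ρ u θ →
        ∀ Φ : (N : ℕ) → Flow σ N,
          TendstoHydroFieldsAt (fun N => localGibbsLaw σ a₀ u₀ θ₀ N (Φ N)) Φ ρ u θ 0 →
            ∀ t ∈ Ico 0 T,
              Tendsto (fun N : ℕ => ((N : ℝ) + 1)⁻¹ *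
                ((klDiv (lawAt σ a₀ θ₀ u₀ N (Φ N) t) (steeredRef σ u θ N (Φ N) t)).toReal
                  - (klDiv ((lawAt σ a₀ θ₀ u₀ N (Φ N) t).map pos)
                      ((steeredRef σ u θ N (Φ N) t).map pos)).toReal))
                atTop (𝓝 0)

/-- The CONFIGURATIONAL HALF: the free-volume ("local") entropy functional
`S_loc(ρ) = -∫ ρ log ρ - ∫ ρ · hsExcessFreeEnergy (ρ σ³)` and its Bregman deficit at the
classical density; the line shows `E[D_N(t)] → 0` jointly with `K_N/N → 0` by ONE Gronwall
inequality, the ceiling `S(pos_# P_t) ≤ (N+1) E S_loc(ρ̄_N(t)) + o(N)` (max-entropy given the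
coarse profile: drop inter-cell exclusions, Ruelle's thermodynamic limit of the free volume,
valid at every reduced density below close packing) paying for the configurational part. -/
def localEntropy (σ : ℝ) (ρ : T3 → ℝ) : ℝ :=
  -(∫ x, ρ x * Real.log (ρ x)) - ∫ x, ρ x * hsExcessFreeEnergy (ρ x * σ ^ 3)

/-- Configurational chemical potential `μ(ρ) = -S_loc'(ρ) = log ρ + f_ex(ρσ³) + ρσ³ f_ex'(ρσ³)`
(the multiplier whose EXACT transport cancellation against the microscopic continuity equation
is the bookkeeping heart of the line). -/
def configChemPot (σ : ℝ) (r : ℝ) : ℝ :=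
  Real.log r + hsExcessFreeEnergy (r * σ ^ 3) + r * σ ^ 3 * deriv hsExcessFreeEnergy (r * σ ^ 3)

/-- Bregman deficit of `S_loc` at `ρcl` in the direction of a block profile `ρb` (≥ 0 by Ruelle
convexity of `η ↦ η log η + η f_ex(η)`; strongly positive where `(βp)'(η) > 0`). -/
def bregmanDeficit (σ : ℝ) (ρcl ρb : T3 → ℝ) : ℝ :=
  localEntropy σ ρcl - (∫ x, configChemPot σ (ρcl x) * (ρb x - ρcl x)) - localEntropy σ ρb

end Summit.AtomisticToContinuum.HydrodynamicLimit.Cruxes.MacroClosure.SteeredMaxwellians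

end
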